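import Summits.BirchSwinnertonDyer.Rank1Residual.X11b.Three.StepLHalves
import Summits.BirchSwinnertonDyer.Rank1Residual.X11b.Three.OpenInputTightLocus
import HarnessLib

/-!
# X11b @ `p = 3`, R7-8 "CTL₀ ON A1": the HALVES hypothesis `CharTorsionAt₃ W` is a THEOREM on the
# atom A1 = X11b@3 ∧ (ram) ∧ `3 ∤ ∏_ℓ c_ℓ(E)`, so there HALVES reads `H1 ∧ H2 ∧ H3 ⇒ Three.StepLAt W`
# (and `⇒ BSD(E,3)` through S3) with `hctl` DISCHARGED

HONEST FRAMING (cell `b2b-bsdres`, run/shared/lean/b2b/bsd-rank1-residual/, verbatim in every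
file): the goal of the cell is to DELETE the COMBINATION-SHAPED residual classes of the
Birch–Swinnerton-Dyer formula for ALL analytic-rank `≤ 1` elliptic curves over `ℚ` — "full BSD
formula for every rank `≤ 1` curve in class `C`" assembled STRICTLY from published theorems — so
that the rank-`≤ 1` remainder becomes exactly the CONSTRUCTION-SHAPED classes, which are TYPED
(missing-input `Prop`s), NOT attempted. This is not "finishing BSD". Team `x11b3` = N8/O2 (X11b at
`p = 3`: `3 ‖ N`, `r_an = 1`, `E[3]` irreducible): RESEARCH ROUTES; published theorems only; the
construction-shaped remainder is TYPED, not attempted; census output = EVIDENCE, never a Literature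
fact; nothing booked; no label change; O2 stays OPEN; no route opened.

PROVENANCE (team `cells/x11b3/`, LEAD DEAL #7 R7-8 "CTL₀ ON A1", owner seat `b2b-bsdres-x11b3-p2`;
decision (a) DERIVABLE): the term of `charTorsionAt₃_of_classX11b_of_ram_of_not_dvd` is route
planner 1's kernel-checked sketch `HOME/b2b-bsdres-x11b3-r1/CTL0OnA1Sketch.lean` (gen. 4, sha16
1f4a152cd96dde97, `charTorsionAt₃_of_locus`), ported against the LANDED `CharTorsionAt₃` /
`stepLAt_of_halves₃` of S10 HALVES@3 (`Three/StepLHalves.lean`, route planner 2's sketch filed by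
seat p7 as proxy for p9). THEOREMS ONLY: no definition, no named fact, no new `@[conjecture]`.

## What is kernel-checked here

* `charTorsionAt₃_of_classX11b_of_ram_of_not_dvd`: **CTL₀@3 (`CharTorsionAt₃ W`) HOLDS on A1**
  (`ClassX11b W 3 ∧ Ram W 3 ∧ ¬ 3 ∣ W.tamagawaProduct`), modulo EXACTLY the five fact binders of
  the tree theorem `X11b.controlOnTreeAt_heegner_odd_of_facts_of_not_dvd`
  (`Three/ControlIdentityLocus.lean` §3, every odd `p`): Kolyvagin (`kolyvagin N W K`: rank
  `E(K) = 1` and `Ш(E/K)` finite at a non-torsion Heegner point) and the four CITED cohomological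
  facts (`poitouTate_selmerStructure_duality`, `poitouTate_sha_tateDual`,
  `localEulerPoincareCharacteristic`, `fieldCdLE_two_of_numberField`). That theorem yields the
  control IDENTITY `ControlOnTreeAt 3 κ 𝔭 γ (embAt K 3 𝔭) P := ∃ n, XAc.HasCharValuationAt (E/K) 3
  κ 𝔭 ∅ γ n ∧ (n = …)`; CTL₀ is its FIRST conjunct. The binders of `CharTorsionAt₃` it does not
  consume (`Surj W 3`, `Odd d_K`, `L(E^{d_K},1) ≠ 0`, `¬ 3 ∣ Dt.c`) are dropped; the two A1
  conditions not among its binders (`Ram W 3`, `¬ 3 ∣ ∏c`) are outer hypotheses — exactly as in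
  `Three.stepLAt_iff_bsdp_of_locus`; `charTorsionAt₃_of_semistable_of_not_dvd`: on a SEMISTABLE
  curve (ram) is automatic (`ram_of_semistable_of_irr_of_le_seven`, Ribet + Diamond's refined
  level-lowering `hLL`).
* `stepLAt_of_halves₃_onA1`: on A1 the HALVES composition `Three.stepLAt_of_halves₃` reads
  `exists_isNewformOf → BDPExistsAt₃ W → BDPValueAt₃ W → IMCDivAt₃ W → Three.StepLAt W` with
  `hctl` DISCHARGED (modulo the five facts).
* `bsdp_of_halves₃_onA1`: through S3 (`Three.stepLAt_iff_bsdp_of_locus`, published + cited facts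
  alone on A1), `H1 ∧ H2 ∧ H3 ⇒ BSDp W 3` on A1; `bsdp_of_halves₃_of_semistable_of_not_dvd` the
  semistable spelling; `missingInputAt_of_halves₃_onA1` the per-pair bookkeeping for the class's
  typed input `X11Three.MissingInputAt W` (REFEREE R6.2).

Off A1 ((T2′)₃: `3 ∣ ∏c`, or no (ram) prime) NOTHING is claimed: there the local kernels at `Σ(N⁺)`
are non-trivial and the tree has no torsion-ness theorem for `X_ac` — CTL₀ stays the hypothesis it
is (Cas18 Thm. 2.3 / JSW17 Thm. 3.3.1 shape). The three halves H1 = W2 (BDP-EXISTS@3), H2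
(BDP-VALUE@3), H3 = MI-W3 stay TYPED, construction-shaped inputs with the R-h labels of
`Three/StepLHalves.lean`; every theorem below is CONDITIONAL on them and on the named/cited facts it
lists; nothing is booked; O2 / N8 unchanged; X11 ∧ r = 1 ∧ p = 3 stays CONSTRUCTION-SHAPED.

References: [Castella2018] Thm. 2.3, §5 (arXiv:1704.06608 pp. 5, 12); [JetchevSkinnerWan2017]
Thm. 3.3.1, Prop. 3.3.4 (arXiv:1512.06894 pp. 11–13); [GreenbergLNM1716] §3 Lemma 3.3 (p. 87);
[Kolyvagin1990] Thm. A; [Miller2011LMS] Def. 1.1; [Ribet1990] Thm. 1.1; [Diamond1995RefinedSerre]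
Thm. 1.1.
-/

noncomputable section

open scoped Classical

open WeierstrassCurve NumberField IsDedekindDomain Field
  Literature.NumberTheory.EllipticCurves Literature.NumberTheory.EllipticCurves.GreenbergSelmer
  Literature.NumberTheory.EllipticCurves.ModularForms Literature.NumberTheory.EllipticCurves.Rank1Residual
  Literature.NumberTheory.EllipticCurves.Rank1Residual.Typed Literature.NumberTheory.EllipticCurves.Wuthrich2014
  Literature.NumberTheory.GaloisRepresentations Literature.NumberTheory.GaloisCohomology
  Summit.BirchSwinnertonDyer.Rank1Residual.X11b.AcSelmer Summit.BirchSwinnertonDyer.Rank1Residual.X11b.LocBridge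

namespace Summit.BirchSwinnertonDyer.Rank1Residual.X11b.Three

variable {W : WeierstrassCurve ℚ} [W.IsElliptic] [W.IsGloballyMinimal]

/-! ## §1. CTL₀@3 is a theorem on A1 -/

/-- **CTL₀@3 HOLDS ON A1** (`ClassX11b W 3 ∧ Ram W 3 ∧ ¬ 3 ∣ ∏_ℓ c_ℓ(E)`), modulo Kolyvagin and
the four cited cohomological facts: the first conjunct of the control identity
`X11b.controlOnTreeAt_heegner_odd_of_facts_of_not_dvd` at `p = 3` (route planner 1's term,
`CTL0OnA1Sketch.lean`). CONDITIONAL on the named/cited facts only; nothing booked; O2 / N8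
unchanged. [cite: Castella2018, Thm. 2.3 (arXiv:1704.06608 p. 5)]
[cite: JetchevSkinnerWan2017, Thm. 3.3.1, Prop. 3.3.4 (arXiv:1512.06894 pp. 11–13)]
[cite: GreenbergLNM1716, §3 Lemma 3.3 (p. 87)] [cite: Kolyvagin1990, Thm. A] -/
theorem charTorsionAt₃_of_classX11b_of_ram_of_not_dvd
    (hKo : ∀ (N : ℕ) [NeZero N] (W : WeierstrassCurve ℚ) (K : Type) [Field K] [NumberField K],
      kolyvagin N W K)
    (hPT : ∀ (K : Type) [Field K] [NumberField K], poitouTate_selmerStructure_duality K)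
    (hPT2 : ∀ (K : Type) [Field K] [NumberField K], poitouTate_sha_tateDual K)
    (hEP : ∀ (K : Type) [Field K] [NumberField K] (v : HeightOneSpectrum (𝓞 K)),
      localEulerPoincareCharacteristic (v.adicCompletion K))
    (hcd : fieldCdLE_two_of_numberField)
    (hX : ClassX11b W 3) (hram : Ram W 3) (htam : ¬ 3 ∣ W.tamagawaProduct) :
    CharTorsionAt₃ W := by
  intro N _ K _ _ Dt H ι P _ _ hN hK _ hHN _ hP _ hPinf κ hκ γ _ 𝔭 h𝔭 he hf
  obtain ⟨-, hp2, hmult, hirr⟩ := hX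
  obtain ⟨n, hn, -⟩ := controlOnTreeAt_heegner_odd_of_facts_of_not_dvd W 3 hKo hPT hPT2 hEP hcd hp2
    hmult hirr hram htam Dt H ι hN hK hHN hP hPinf hκ γ 𝔭 h𝔭 he hf
  exact ⟨n, hn⟩

/-- **CTL₀@3 on a SEMISTABLE X11b@3 curve with `3 ∤ ∏_ℓ c_ℓ(E)`** — (ram) is automatic for a
semistable curve with `E[3]` irreducible (`ram_of_semistable_of_irr_of_le_seven`: Ribet's
level-lowering closed off by Diamond's refined version `hLL` and `S_k(SL₂(ℤ)) = 0`, `k < 12`).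
CONDITIONAL on the named/cited facts; nothing booked. [cite: Castella2018, Thm. 2.3 (arXiv:1704.06608 p. 5)]
[cite: Ribet1990, Thm. 1.1] [cite: Diamond1995RefinedSerre, Thm. 1.1] -/
theorem charTorsionAt₃_of_semistable_of_not_dvd
    (hKo : ∀ (N : ℕ) [NeZero N] (W : WeierstrassCurve ℚ) (K : Type) [Field K] [NumberField K],
      kolyvagin N W K)
    (hPT : ∀ (K : Type) [Field K] [NumberField K], poitouTate_selmerStructure_duality K)
    (hPT2 : ∀ (K : Type) [Field K] [NumberField K], poitouTate_sha_tateDual K)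
    (hEP : ∀ (K : Type) [Field K] [NumberField K] (v : HeightOneSpectrum (𝓞 K)),
      localEulerPoincareCharacteristic (v.adicCompletion K))
    (hcd : fieldCdLE_two_of_numberField) (hnf : exists_isNewformOf)
    (hLL : Literature.NumberTheory.Automorphic.diamond1995_refinedSerre)
    (hsst : Semistable W) (hX : ClassX11b W 3) (htam : ¬ 3 ∣ W.tamagawaProduct) :
    CharTorsionAt₃ W :=
  charTorsionAt₃_of_classX11b_of_ram_of_not_dvd hKo hPT hPT2 hEP hcd hX
    (ram_of_semistable_of_irr_of_le_seven hnf hLL W 3 hX.2.1 (by norm_num) hsst hX.2.2.2) htam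

/-! ## §2. HALVES on A1 with `hctl` discharged -/

/-- **S10 HALVES@3 ON A1, `hctl` DISCHARGED**: on A1 (`ClassX11b W 3 ∧ Ram W 3 ∧ ¬ 3 ∣ ∏c`),
`exists_isNewformOf ∧ H1 ∧ H2 ∧ H3 ⟹ Three.StepLAt W` — `Three.stepLAt_of_halves₃` with its
hypothesis `CharTorsionAt₃ W` supplied by `charTorsionAt₃_of_classX11b_of_ram_of_not_dvd`
(Kolyvagin + the four cited cohomological facts). H1 = BDP-EXISTS@3 (W2), H2 = BDP-VALUE@3,
H3 = MI-W3 stay TYPED hypotheses (construction-shaped, labels in `Three/StepLHalves.lean`);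
nothing asserted, nothing booked; O2 OPEN. [cite: Castella2018, Thm. 2.3 (p. 5), §5 (p. 12) (arXiv:1704.06608; assembly shape, inputs typed)] -/
theorem stepLAt_of_halves₃_onA1
    (hKo : ∀ (N : ℕ) [NeZero N] (W : WeierstrassCurve ℚ) (K : Type) [Field K] [NumberField K],
      kolyvagin N W K)
    (hPT : ∀ (K : Type) [Field K] [NumberField K], poitouTate_selmerStructure_duality K)
    (hPT2 : ∀ (K : Type) [Field K] [NumberField K], poitouTate_sha_tateDual K)
    (hEP : ∀ (K : Type) [Field K] [NumberField K] (v : HeightOneSpectrum (𝓞 K)),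
      localEulerPoincareCharacteristic (v.adicCompletion K))
    (hcd : fieldCdLE_two_of_numberField)
    (hnf : exists_isNewformOf) (hX : ClassX11b W 3) (hram : Ram W 3)
    (htam : ¬ 3 ∣ W.tamagawaProduct)
    (h1 : BDPExistsAt₃ W) (h2 : BDPValueAt₃ W) (h3 : IMCDivAt₃ W) : StepLAt W :=
  stepLAt_of_halves₃ hnf (charTorsionAt₃_of_classX11b_of_ram_of_not_dvd hKo hPT hPT2 hEP hcd hX hram
    htam) h1 h2 h3

/-! ## §3. Through S3: HALVES ⟹ `BSD(E,3)` on A1 from published + cited facts -/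

/-- **`H1 ∧ H2 ∧ H3 ⟹ BSD(E,3)` ON A1** — `stepLAt_of_halves₃_onA1` composed with S3's tightness
`Three.stepLAt_iff_bsdp_of_locus` (THE open input ⟺ `BSDp W 3` on A1 from the twelve published
named facts + the cited cohomological facts). The three halves stay TYPED hypotheses; CONDITIONAL on
every listed fact binder; per pair, not a class statement; nothing booked; no label change; O2 OPEN.
[cite: Castella2018, Thm. 2.3 (p. 5), Thm. 3.2 (p. 9), §5 (p. 12)] [cite: JetchevSkinnerWan2017, Thm. 3.3.1 (p. 11), §7.4.1–7.4.3 (pp. 30–31)]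
[cite: GreenbergLNM1716, §3 Lemma 3.3 (p. 87)] [cite: Miller2011LMS, Def. 1.1] -/
theorem bsdp_of_halves₃_onA1
    (hGZ : ∀ (N : ℕ) [NeZero N] (W : WeierstrassCurve ℚ) (K : Type) [Field K] [NumberField K],
      gross_zagier N W K)
    (hKo : ∀ (N : ℕ) [NeZero N] (W : WeierstrassCurve ℚ) (K : Type) [Field K] [NumberField K],
      kolyvagin N W K)
    (hB : ∀ (N : ℕ) [NeZero N] (W : WeierstrassCurve ℚ) (K : Type) [Field K] [NumberField K],
      Kolyvagin1990_padicValNat_card_sha_le N W K)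
    (hSk : Skinner2016.thmC_padicValRat_bsd_rank_zero) (hWu : sha_dvd_analyticSha)
    (hGZK : rank_eq_analyticRank_of_analyticRank_le_one) (hmod : hasEntireLFunction_rat)
    (hnf : exists_isNewformOf) (hHL : HoffsteinLuo1997_exists_twist_L_one_ne_zero)
    (hMaz : mazur_not_dvd_maninConstant_of_odd)
    (hPT : ∀ (K : Type) [Field K] [NumberField K], poitouTate_sum_localTatePairing_eq_zero K)
    (hEP : ∀ (K : Type) [Field K] [NumberField K] (v : HeightOneSpectrum (𝓞 K)),
      localEulerPoincareCharacteristic (v.adicCompletion K))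
    (hPTs : ∀ (K : Type) [Field K] [NumberField K], poitouTate_selmerStructure_duality K)
    (hPT2 : ∀ (K : Type) [Field K] [NumberField K], poitouTate_sha_tateDual K)
    (hcd : fieldCdLE_two_of_numberField)
    (hX : ClassX11b W 3) (hram : Ram W 3) (htam : ¬ 3 ∣ W.tamagawaProduct)
    (h1 : BDPExistsAt₃ W) (h2 : BDPValueAt₃ W) (h3 : IMCDivAt₃ W) : BSDp W 3 :=
  (stepLAt_iff_bsdp_of_locus W hGZ hKo hB hSk hWu hGZK hmod hnf hHL hMaz hPT hEP hPTs hPT2 hcd hX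
      hram htam).mp
    (stepLAt_of_halves₃_onA1 hKo hPTs hPT2 hEP hcd hnf hX hram htam h1 h2 h3)

/-- **`H1 ∧ H2 ∧ H3 ⟹ BSD(E,3)` on a SEMISTABLE X11b@3 curve with `3 ∤ ∏_ℓ c_ℓ(E)`** ((ram)
automatic by `ram_of_semistable_of_irr_of_le_seven`, Diamond's refined level-lowering `hLL`).
CONDITIONAL on every listed fact binder and on the three typed halves; nothing booked.
[cite: Castella2018, Thm. 2.3 (p. 5), Thm. 3.2 (p. 9), §5 (p. 12)] [cite: Ribet1990, Thm. 1.1]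
[cite: Diamond1995RefinedSerre, Thm. 1.1] [cite: Miller2011LMS, Def. 1.1] -/
theorem bsdp_of_halves₃_of_semistable_of_not_dvd
    (hGZ : ∀ (N : ℕ) [NeZero N] (W : WeierstrassCurve ℚ) (K : Type) [Field K] [NumberField K],
      gross_zagier N W K)
    (hKo : ∀ (N : ℕ) [NeZero N] (W : WeierstrassCurve ℚ) (K : Type) [Field K] [NumberField K],
      kolyvagin N W K)
    (hB : ∀ (N : ℕ) [NeZero N] (W : WeierstrassCurve ℚ) (K : Type) [Field K] [NumberField K],
      Kolyvagin1990_padicValNat_card_sha_le N W K)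
    (hSk : Skinner2016.thmC_padicValRat_bsd_rank_zero) (hWu : sha_dvd_analyticSha)
    (hGZK : rank_eq_analyticRank_of_analyticRank_le_one) (hmod : hasEntireLFunction_rat)
    (hnf : exists_isNewformOf) (hHL : HoffsteinLuo1997_exists_twist_L_one_ne_zero)
    (hMaz : mazur_not_dvd_maninConstant_of_odd)
    (hPT : ∀ (K : Type) [Field K] [NumberField K], poitouTate_sum_localTatePairing_eq_zero K)
    (hEP : ∀ (K : Type) [Field K] [NumberField K] (v : HeightOneSpectrum (𝓞 K)),
      localEulerPoincareCharacteristic (v.adicCompletion K))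
    (hPTs : ∀ (K : Type) [Field K] [NumberField K], poitouTate_selmerStructure_duality K)
    (hPT2 : ∀ (K : Type) [Field K] [NumberField K], poitouTate_sha_tateDual K)
    (hcd : fieldCdLE_two_of_numberField)
    (hLL : Literature.NumberTheory.Automorphic.diamond1995_refinedSerre)
    (hsst : Semistable W) (hX : ClassX11b W 3) (htam : ¬ 3 ∣ W.tamagawaProduct)
    (h1 : BDPExistsAt₃ W) (h2 : BDPValueAt₃ W) (h3 : IMCDivAt₃ W) : BSDp W 3 :=
  bsdp_of_halves₃_onA1 hGZ hKo hB hSk hWu hGZK hmod hnf hHL hMaz hPT hEP hPTs hPT2 hcd hX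
    (ram_of_semistable_of_irr_of_le_seven hnf hLL W 3 hX.2.1 (by norm_num) hsst hX.2.2.2) htam h1 h2
    h3

/-- **Per-pair bookkeeping (REFEREE R6.2)**: on A1, under the halves and the listed facts, the
CLASS's typed missing input `X11Three.MissingInputAt W` holds at the pair `(E, 3)`
(`X11Three.missingInputAt_of_bsdp`; `ord_{s=1} L(E,s) = 1` from `ClassX11b W 3`). A certified pair is
no counter-instance to the typed `Prop`; the `Prop` itself (a statement about the CLASS) is NOT made
available; nothing booked. [cite: Miller2011LMS, §1 and Def. 1.1 (arXiv:1010.2431 p. 3)] -/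
theorem missingInputAt_of_halves₃_onA1
    (hGZ : ∀ (N : ℕ) [NeZero N] (W : WeierstrassCurve ℚ) (K : Type) [Field K] [NumberField K],
      gross_zagier N W K)
    (hKo : ∀ (N : ℕ) [NeZero N] (W : WeierstrassCurve ℚ) (K : Type) [Field K] [NumberField K],
      kolyvagin N W K)
    (hB : ∀ (N : ℕ) [NeZero N] (W : WeierstrassCurve ℚ) (K : Type) [Field K] [NumberField K],
      Kolyvagin1990_padicValNat_card_sha_le N W K)
    (hSk : Skinner2016.thmC_padicValRat_bsd_rank_zero) (hWu : sha_dvd_analyticSha)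
    (hGZK : rank_eq_analyticRank_of_analyticRank_le_one) (hmod : hasEntireLFunction_rat)
    (hnf : exists_isNewformOf) (hHL : HoffsteinLuo1997_exists_twist_L_one_ne_zero)
    (hMaz : mazur_not_dvd_maninConstant_of_odd)
    (hPT : ∀ (K : Type) [Field K] [NumberField K], poitouTate_sum_localTatePairing_eq_zero K)
    (hEP : ∀ (K : Type) [Field K] [NumberField K] (v : HeightOneSpectrum (𝓞 K)),
      localEulerPoincareCharacteristic (v.adicCompletion K))
    (hPTs : ∀ (K : Type) [Field K] [NumberField K], poitouTate_selmerStructure_duality K)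
    (hPT2 : ∀ (K : Type) [Field K] [NumberField K], poitouTate_sha_tateDual K)
    (hcd : fieldCdLE_two_of_numberField)
    (hX : ClassX11b W 3) (hram : Ram W 3) (htam : ¬ 3 ∣ W.tamagawaProduct)
    (h1 : BDPExistsAt₃ W) (h2 : BDPValueAt₃ W) (h3 : IMCDivAt₃ W) :
    X11Three.MissingInputAt W :=
  X11Three.missingInputAt_of_bsdp hmod hGZK W (le_of_eq hX.1)
    (bsdp_of_halves₃_onA1 hGZ hKo hB hSk hWu hGZK hmod hnf hHL hMaz hPT hEP hPTs hPT2 hcd hX hram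
      htam h1 h2 h3)

end Summit.BirchSwinnertonDyer.Rank1Residual.X11b.Three

end
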